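import Literature.Analysis.FluidPDE.PassiveScalarVelocityStability
import Literature.Analysis.FluidPDE.PassiveScalarGradientTransport
import HarnessLib

/-!
# Gradients of passive scalars: the differentiated equation, and linear growth in shear flows

Topic `Literature/Analysis/FluidPDE` (support file, all results proved; no definitions, no named
facts) for the accepted notion `Torus.IsClassicalScalarTransportOn S κ u φ` (`PassiveScalar`).
Differentiating `∂ₜφ + u·∇φ = κΔφ` in the direction `eₖ` gives the differentiated equation
`∂ₜ(∂ₖφ) + u·∇(∂ₖφ) = κΔ(∂ₖφ) - ⟪∂ₖu, ∇φ⟫` — the tree's `….partialDeriv_transport`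
(`PassiveScalarGradientTransport`, which draws the SUP-NORM envelope from it by the maximum principle);
this file draws the `L²` consequences: the balance
`d/dt ‖∂ₖφ‖² = -2κ‖∇∂ₖφ‖² - 2∫ ∂ₖφ ⟪∂ₖu, ∇φ⟫` (`….hasDerivWithinAt_integral_partialDeriv_sq`; the
transport term vanishes by incompressibility). For a **shear flow** `u = b(t, x) eᵢ` with `∂ᵢb = 0`
(the phases of alternating-shear / sawtooth cascades) this is the classical kinematics of gradient
growth, in energy form and for every `κ ≥ 0`:

* `….partialDeriv_of_partialDeriv_velocity_eq_zero` — if `∂ᵢu ≡ 0` then `∂ᵢφ` is again a classical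
  solution (the forcing `⟪∂ᵢu, ∇φ⟫` vanishes), so `‖∂ᵢφ(t)‖_{L²}` is non-increasing
  (`….integral_partialDeriv_sq_le_of_partialDeriv_velocity_eq_zero`);
* `….sqrt_integral_partialDeriv_sq_le_of_shear` — for `u = (u·eᵢ) eᵢ` with `∂ᵢu ≡ 0` and
  `‖∂ⱼu(t, ·)‖ ≤ M(t)`: `‖∂ⱼφ(t)‖_{L²} ≤ ‖∂ⱼφ(a)‖_{L²} + (∫ₐᵗ M) ‖∂ᵢφ(a)‖_{L²}` — LINEAR growth
  (for the transported scalar `φ(t, x) = φ₀(x - eᵢ∫b)` one has `∂ⱼφ = ∂ⱼφ₀ - (∫∂ⱼb) ∂ᵢφ₀`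
  exactly; the energy method gives the same bound with diffusion, which only helps), as opposed to
  the Grönwall bound `e^{∫‖∇u‖_∞}` valid for general drifts (Feng–Iyer 2019, Lemma 5.1).

Requested by the cell ad-ideate-p2 (block B2 of the K1loc split: the Jacobian bound for the
cascade phase by phase, `(‖∂₁φ‖, ‖∂₂φ‖) ↦ ((1, 0), (γ, 1))` per half pulse instead of `e^{2γ}`).

## Mathlib / tree search

Tree (reused): `IsClassicalScalarTransportOn.partialDeriv_transport` (`PassiveScalarGradientTransport`:
the differentiated equation; its sup-norm twins `abs_partialDeriv_le_of_partialDeriv_velocity_eq_zero`,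
`abs_partialDeriv_le_add_mul_integral_of_shear`), `Torus.partialDeriv_smul`,
`Torus.inner_gradient_left`, `Torus.partialDeriv_eq_fderiv_apply`,
`IsClassicalScalarTransportOn.antitoneOn_scalarL2Sq`, `integral_mul_laplacian_self_eq_neg_scalarGradNormSq`,
`integral_mul_inner_gradient_self_eq_zero` (`PassiveScalarClassicalEnergy`),
`FluidPDE.Torus.sqrt_le_sqrt_add_integral_of_hasDerivWithinAt` (`PassiveScalarVelocityStability`),
`FunctionSpaces.Torus.integral_mul_le_sqrt_mul_sqrt` (`TorusDiffMonomialBounds`); searched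
`partialDeriv` with `IsClassicalScalarTransportOn`, `shear` with `gradient`: only the Fourier-side
`PassiveScalarShearFibreDamping`. Mathlib: `HasDerivWithinAt.comp`,
`intervalIntegral.integral_comp_add_right`.

## References

* Y. Feng, G. Iyer, *Dissipation enhancement by mixing*, Nonlinearity 32 (2019) 1810–1851,
  arXiv:1806.03699, §5.1 Lemma 5.1 (`H¹` growth of transported scalars, `e^{‖∇u‖_∞(t-s)}` for a
  general drift; proof: differentiate the transport equation). [FengIyer2019]
* J. Bedrossian, M. Coti Zelati, *Enhanced dissipation, hypoellipticity, and anomalous small noise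
  inviscid limits in shear flows*, Arch. Ration. Mech. Anal. 224 (2017), arXiv:1510.08098, §1–§2
  (passive scalars in shear flows `u = (u(y), 0)`: the streamwise derivative commutes with the
  equation). [BedrossianCotiZelati2017]
-/

open MeasureTheory Set Filter
open _root_.Topology
open scoped InnerProductSpace ContDiff ENNReal NNReal

noncomputable section

namespace Literature.Analysis.FluidPDE

namespace Torus

variable {d : Type*} [Fintype d] [DecidableEq d]

/-! ## A comparison lemma on a general interval -/

omit [Fintype d] [DecidableEq d] in
/-- The comparison lemma `φ' ≤ 2√φ·g ⇒ √φ(b) ≤ √φ(a) + ∫ₐᵇ g` on a general interval `[a, b]`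
(translate `FluidPDE.Torus.sqrt_le_sqrt_add_integral_of_hasDerivWithinAt` from `[0, b - a]`). [folklore] -/
private theorem sqrt_le_sqrt_add_integral_Icc {φ D g : ℝ → ℝ} {a b : ℝ} (hab : a ≤ b)
    (hφ : ∀ t ∈ Icc a b, HasDerivWithinAt φ (D t) (Icc a b) t) (hD : ContinuousOn D (Icc a b))
    (hpos : ∀ t ∈ Icc a b, 0 ≤ φ t) (hle : ∀ t ∈ Icc a b, D t ≤ 2 * Real.sqrt (φ t) * g t)
    (hg0 : ∀ t ∈ Icc a b, 0 ≤ g t) (hg : ContinuousOn g (Icc a b)) :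
    Real.sqrt (φ b) ≤ Real.sqrt (φ a) + ∫ t in a..b, g t := by
  set T : ℝ := b - a with hT
  have hT0 : 0 ≤ T := by simp only [hT]; linarith
  have hmaps : MapsTo (fun τ : ℝ => τ + a) (Icc 0 T) (Icc a b) := by
    intro τ hτ
    exact ⟨by linarith [hτ.1], by simp only [hT] at hτ; linarith [hτ.2]⟩
  have hsh : ContinuousOn (fun τ : ℝ => τ + a) (Icc 0 T) := (continuousOn_id.add continuousOn_const)
  have hφ' : ∀ τ ∈ Icc (0 : ℝ) T, HasDerivWithinAt (fun τ => φ (τ + a)) (D (τ + a)) (Icc 0 T) τ := by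
    intro τ hτ
    have h1 : HasDerivWithinAt (fun τ : ℝ => τ + a) 1 (Icc 0 T) τ := (hasDerivWithinAt_id τ _).add_const a
    have h2 := (hφ (τ + a) (hmaps hτ)).comp τ h1 hmaps
    simpa [Function.comp_def] using h2
  have hD' : ContinuousOn (fun τ => D (τ + a)) (Icc 0 T) := hD.comp hsh hmaps
  have hg' : ContinuousOn (fun τ => g (τ + a)) (Icc 0 T) := hg.comp hsh hmaps
  have hmain := sqrt_le_sqrt_add_integral_of_hasDerivWithinAt hT0 hφ' hD'
    (fun τ hτ => hpos _ (hmaps hτ)) (fun τ hτ => hle _ (hmaps hτ)) (fun τ hτ => hg0 _ (hmaps hτ))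
    (hg'.intervalIntegrable_of_Icc hT0)
  have hint : ∫ τ in (0 : ℝ)..T, g (τ + a) = ∫ t in a..b, g t := by
    rw [intervalIntegral.integral_comp_add_right]
    simp [hT]
  simpa [hint, hT] using hmain

namespace IsClassicalScalarTransportOn

/-! ## The differentiated equation -/

section Differentiated

variable {a b κ : ℝ} {u : ℝ → UnitAddTorus d → EuclideanSpace ℝ d} {φ : ℝ → UnitAddTorus d → ℝ}

/-- **If the drift does not depend on `xᵢ`, the streamwise derivative `∂ᵢφ` is again a classical
solution** of the same advection–diffusion equation on `[a, b]` (the forcing `⟪∂ᵢu, ∇φ⟫` of the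
differentiated equation vanishes): for shear flows the streamwise derivative commutes with the
equation. [cite: BedrossianCotiZelati2017, §2 (shear flows: `∂ₓ` commutes with `∂ₜ + u(y)∂ₓ - νΔ`)] -/
theorem partialDeriv_of_partialDeriv_velocity_eq_zero (h : IsClassicalScalarTransportOn (Icc a b) κ u φ)
    (hab : a < b) (i : d)
    (hinv : ∀ t ∈ Icc a b, ∀ x, FunctionSpaces.Torus.partialDeriv i (u t) x = 0) :
    IsClassicalScalarTransportOn (Icc a b) κ u (fun t => FunctionSpaces.Torus.partialDeriv i (φ t)) where
  smooth_velocity := h.smooth_velocity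
  smooth_scalar := h.smooth_scalar.partialDeriv (uniqueDiffOn_Icc hab) i
  transport t ht x := by
    have e := h.partialDeriv_transport hab i ht x
    rw [hinv t ht x, inner_zero_left, neg_zero, add_zero] at e
    exact e
  divFree := h.divFree

/-- **Balance law for a partial derivative.** For a classical solution on `[a, b] × T^d` (`a < b`)
and a direction `eₖ`, within `[a, b]`:
`d/dt ∫ (∂ₖφ)² = -2κ‖∇∂ₖφ‖²_{L²} - 2∫ ∂ₖφ ⟪∂ₖu, ∇φ⟫` (pair the differentiated equation with `∂ₖφ`;
`∫ ∂ₖφ ⟪u, ∇∂ₖφ⟫ = 0` by incompressibility, `∫ ∂ₖφ Δ∂ₖφ = -‖∇∂ₖφ‖²`).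
[cite: FengIyer2019, §5.1 Lemma 5.1 (energy form of the `H¹` estimate)] -/
theorem hasDerivWithinAt_integral_partialDeriv_sq (h : IsClassicalScalarTransportOn (Icc a b) κ u φ)
    (hab : a < b) (k : d) {t : ℝ} (ht : t ∈ Icc a b) :
    HasDerivWithinAt (fun s => ∫ x, (FunctionSpaces.Torus.partialDeriv k (φ s) x) ^ 2)
      (-(2 * κ) * scalarGradNormSq (FunctionSpaces.Torus.partialDeriv k (φ t)) -
        2 * ∫ x, FunctionSpaces.Torus.partialDeriv k (φ t) x *
          ⟪FunctionSpaces.Torus.partialDeriv k (u t) x, FunctionSpaces.Torus.gradient (φ t) x⟫_ℝ)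
      (Icc a b) t := by
  have hU : UniqueDiffOn ℝ (Icc a b) := uniqueDiffOn_Icc hab
  have hconv : Convex ℝ (Icc a b) := convex_Icc a b
  set ψ : ℝ → UnitAddTorus d → ℝ := fun s x => FunctionSpaces.Torus.partialDeriv k (φ s) x with hψ_def
  have hψs : FunctionSpaces.Torus.IsSmoothSpaceTimeOn (Icc a b) ψ := h.smooth_scalar.partialDeriv hU k
  have hψt : FunctionSpaces.Torus.IsSmooth (ψ t) := hψs.isSmooth_slice ht
  have hφt : FunctionSpaces.Torus.IsSmooth (φ t) := h.smooth_scalar.isSmooth_slice ht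
  have hut : FunctionSpaces.Torus.IsSmooth (u t) := h.smooth_velocity.isSmooth_slice ht
  -- differentiate `∫ ψ²` under the integral sign
  have hΨ : FunctionSpaces.Torus.IsSmoothSpaceTimeOn (Icc a b) (fun s x => ψ s x * ψ s x) := hψs.mul hψs
  have hE := hΨ.hasDerivWithinAt_integral hconv ht
  have htd : ∀ x, FunctionSpaces.Torus.timeDerivWithin (Icc a b) (fun s x => ψ s x * ψ s x) t x =
      2 * (ψ t x * FunctionSpaces.Torus.timeDerivWithin (Icc a b) ψ t x) := by
    intro x
    have h2 : HasDerivWithinAt (fun τ => ψ τ x * ψ τ x)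
        (FunctionSpaces.Torus.timeDerivWithin (Icc a b) ψ t x * ψ t x +
          ψ t x * FunctionSpaces.Torus.timeDerivWithin (Icc a b) ψ t x) (Icc a b) t :=
      (hψs.hasDerivWithinAt_slice ht x).mul (hψs.hasDerivWithinAt_slice ht x)
    rw [FunctionSpaces.Torus.timeDerivWithin, h2.derivWithin (hU t ht)]
    ring
  have hfun : (fun s => ∫ x, (FunctionSpaces.Torus.partialDeriv k (φ s) x) ^ 2) =
      fun s => ∫ x, ψ s x * ψ s x := by
    funext s
    simp only [sq, hψ_def]
  rw [hfun]
  refine hE.congr_deriv ?_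
  -- the differentiated equation, pointwise
  have hpt : (fun x => FunctionSpaces.Torus.timeDerivWithin (Icc a b) (fun s x => ψ s x * ψ s x) t x) =
      fun x => 2 * κ * (ψ t x * FunctionSpaces.Torus.laplacian (ψ t) x) -
        2 * (ψ t x * ⟪FunctionSpaces.Torus.partialDeriv k (u t) x, FunctionSpaces.Torus.gradient (φ t) x⟫_ℝ) -
        2 * (ψ t x * ⟪u t x, FunctionSpaces.Torus.gradient (ψ t) x⟫_ℝ) := by
    funext x
    rw [htd x]
    have e0 := h.partialDeriv_transport hab k ht x
    have e : FunctionSpaces.Torus.timeDerivWithin (Icc a b)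
        (fun s => FunctionSpaces.Torus.partialDeriv k (φ s)) t x =
        κ * FunctionSpaces.Torus.laplacian (FunctionSpaces.Torus.partialDeriv k (φ t)) x -
          ⟪FunctionSpaces.Torus.partialDeriv k (u t) x, FunctionSpaces.Torus.gradient (φ t) x⟫_ℝ -
          ⟪u t x, FunctionSpaces.Torus.gradient (FunctionSpaces.Torus.partialDeriv k (φ t)) x⟫_ℝ := by
      linarith
    have hψ' : ψ = fun s => FunctionSpaces.Torus.partialDeriv k (φ s) := rfl
    rw [hψ', e]
    ring
  have i1 : Integrable (fun x => ψ t x * FunctionSpaces.Torus.laplacian (ψ t) x) volume :=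
    (hψt.smul' hψt.laplacian).integrable
  have i2 : Integrable (fun x => ψ t x *
      ⟪FunctionSpaces.Torus.partialDeriv k (u t) x, FunctionSpaces.Torus.gradient (φ t) x⟫_ℝ) volume :=
    (hψt.smul' ((hut.partialDeriv k).inner hφt.gradient)).integrable
  have i3 : Integrable (fun x => ψ t x * ⟪u t x, FunctionSpaces.Torus.gradient (ψ t) x⟫_ℝ) volume :=
    (hψt.smul' (hut.inner hψt.gradient)).integrable
  have j1 : Integrable (fun x => 2 * κ * (ψ t x * FunctionSpaces.Torus.laplacian (ψ t) x)) volume :=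
    i1.const_mul _
  have j2 : Integrable (fun x => 2 * (ψ t x *
      ⟪FunctionSpaces.Torus.partialDeriv k (u t) x, FunctionSpaces.Torus.gradient (φ t) x⟫_ℝ)) volume :=
    i2.const_mul _
  have j3 : Integrable (fun x => 2 * (ψ t x * ⟪u t x, FunctionSpaces.Torus.gradient (ψ t) x⟫_ℝ)) volume :=
    i3.const_mul _
  have j12 : Integrable (fun x => 2 * κ * (ψ t x * FunctionSpaces.Torus.laplacian (ψ t) x) -
      2 * (ψ t x * ⟪FunctionSpaces.Torus.partialDeriv k (u t) x,
        FunctionSpaces.Torus.gradient (φ t) x⟫_ℝ)) volume := j1.sub j2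
  rw [hpt, integral_sub j12 j3, integral_sub j1 j2, integral_const_mul, integral_const_mul,
    integral_const_mul, integral_mul_laplacian_self_eq_neg_scalarGradNormSq hψt,
    integral_mul_inner_gradient_self_eq_zero hut (h.divFree t ht) hψt]
  simp only [hψ_def]
  ring

end Differentiated

/-! ## Shear flows: the streamwise derivative decays, the cross derivative grows linearly -/

section Shear

variable {S : Set ℝ} {κ : ℝ} {u : ℝ → UnitAddTorus d → EuclideanSpace ℝ d}
  {φ : ℝ → UnitAddTorus d → ℝ}

/-- **The streamwise derivative does not grow.** If the drift does not depend on `xᵢ` on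
`[a, b] ⊆ S` (`∂ᵢu ≡ 0`) and `κ ≥ 0`, then `‖∂ᵢφ(t)‖²_{L²} ≤ ‖∂ᵢφ(a)‖²_{L²}` for `t ∈ [a, b]`
(`∂ᵢφ` solves the same equation; its energy is non-increasing).
[cite: BedrossianCotiZelati2017, §2 (shear flows: `∂ₓ` commutes with the equation)] -/
theorem integral_partialDeriv_sq_le_of_partialDeriv_velocity_eq_zero
    (h : IsClassicalScalarTransportOn S κ u φ) (hκ : 0 ≤ κ) {a b : ℝ} (hI : Icc a b ⊆ S) (i : d)
    (hinv : ∀ t ∈ Icc a b, ∀ x, FunctionSpaces.Torus.partialDeriv i (u t) x = 0)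
    {t : ℝ} (ht : t ∈ Icc a b) :
    ∫ x, (FunctionSpaces.Torus.partialDeriv i (φ t) x) ^ 2 ≤
      ∫ x, (FunctionSpaces.Torus.partialDeriv i (φ a) x) ^ 2 := by
  rcases eq_or_lt_of_le ht.1 with hta | hat
  · subst hta
    exact le_rfl
  have hab : a < b := hat.trans_le ht.2
  have hp := (h.restrict_Icc hab hI).partialDeriv_of_partialDeriv_velocity_eq_zero hab i hinv
  have hmono := hp.antitoneOn_scalarL2Sq hκ (a := a) (b := b) Subset.rfl
  have := hmono (left_mem_Icc.2 hab.le) ht ht.1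
  simpa [scalarL2Sq] using this

/-- **Linear growth of the cross derivative in a shear flow** (energy form, any `κ ≥ 0`). Let `φ`
be a classical solution of `∂ₜφ + u·∇φ = κΔφ` on `S ⊇ [a, b]` whose drift is a shear flow in the
direction `eᵢ` on `[a, b]`: `u = (u·eᵢ) eᵢ`, `∂ᵢu ≡ 0`, with `‖∂ⱼu(t, x)‖ ≤ M(t)`, `M` continuous.
Then for `t ∈ [a, b]`,
`‖∂ⱼφ(t)‖_{L²} ≤ ‖∂ⱼφ(a)‖_{L²} + (∫ₐᵗ M) ‖∂ᵢφ(a)‖_{L²}`: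
by the balance law `d/dt‖∂ⱼφ‖² = -2κ‖∇∂ⱼφ‖² - 2∫ ∂ⱼφ (∂ⱼuᵢ) ∂ᵢφ ≤ 2M‖∂ⱼφ‖‖∂ᵢφ‖ ≤ 2M‖∂ⱼφ‖‖∂ᵢφ(a)‖`
(the streamwise derivative does not grow) and the comparison lemma. For the transported scalar
(`κ = 0`, `φ = φ₀(x - eᵢ∫u)`) this is the exact shear kinematics `∂ⱼφ = ∂ⱼφ₀ - (∫∂ⱼuᵢ) ∂ᵢφ₀`, linear
in time — as opposed to the Grönwall bound `e^{‖∇u‖_∞ (t - a)}` for a general drift.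
[cite: FengIyer2019, §5.1 Lemma 5.1 (general drift, exponential bound; shear case)]
[cite: BedrossianCotiZelati2017, §1–§2 (passive scalars in shear flows)] -/
theorem sqrt_integral_partialDeriv_sq_le_of_shear (h : IsClassicalScalarTransportOn S κ u φ) (hκ : 0 ≤ κ)
    {a b : ℝ} (hI : Icc a b ⊆ S) (i j : d)
    (hdir : ∀ t ∈ Icc a b, ∀ x, u t x = (u t x i) • EuclideanSpace.single i (1 : ℝ))
    (hinv : ∀ t ∈ Icc a b, ∀ x, FunctionSpaces.Torus.partialDeriv i (u t) x = 0)
    {M : ℝ → ℝ} (hM : ∀ t ∈ Icc a b, ∀ x, ‖FunctionSpaces.Torus.partialDeriv j (u t) x‖ ≤ M t)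
    (hMc : ContinuousOn M (Icc a b)) {t : ℝ} (ht : t ∈ Icc a b) :
    Real.sqrt (∫ x, (FunctionSpaces.Torus.partialDeriv j (φ t) x) ^ 2) ≤
      Real.sqrt (∫ x, (FunctionSpaces.Torus.partialDeriv j (φ a) x) ^ 2) +
        (∫ s in a..t, M s) * Real.sqrt (∫ x, (FunctionSpaces.Torus.partialDeriv i (φ a) x) ^ 2) := by
  rcases eq_or_lt_of_le ht.1 with hta | hat
  · subst hta
    simp
  have hab : a < b := hat.trans_le ht.2
  -- work on `[a, t]`
  have hIt : Icc a t ⊆ S := (Icc_subset_Icc_right ht.2).trans hI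
  have h' := h.restrict_Icc hat hIt
  have hU : UniqueDiffOn ℝ (Icc a t) := uniqueDiffOn_Icc hat
  have hconv : Convex ℝ (Icc a t) := convex_Icc a t
  have hsubI : Icc a t ⊆ Icc a b := Icc_subset_Icc_right ht.2
  set P : ℝ := Real.sqrt (∫ x, (FunctionSpaces.Torus.partialDeriv i (φ a) x) ^ 2) with hP_def
  have hP0 : 0 ≤ P := Real.sqrt_nonneg _
  -- energy of the cross derivative and its derivative
  set E : ℝ → ℝ := fun s => ∫ x, (FunctionSpaces.Torus.partialDeriv j (φ s) x) ^ 2 with hE_def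
  set D : ℝ → ℝ := fun s => -(2 * κ) * scalarGradNormSq (FunctionSpaces.Torus.partialDeriv j (φ s)) -
      2 * ∫ x, FunctionSpaces.Torus.partialDeriv j (φ s) x *
        ⟪FunctionSpaces.Torus.partialDeriv j (u s) x, FunctionSpaces.Torus.gradient (φ s) x⟫_ℝ with hD_def
  have hEd : ∀ s ∈ Icc a t, HasDerivWithinAt E (D s) (Icc a t) s := fun s hs =>
    h'.hasDerivWithinAt_integral_partialDeriv_sq hat j hs
  have hψs : FunctionSpaces.Torus.IsSmoothSpaceTimeOn (Icc a t)
      (fun s => FunctionSpaces.Torus.partialDeriv j (φ s)) := h'.smooth_scalar.partialDeriv hU j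
  have hDc : ContinuousOn D (Icc a t) := by
    have hg1 := hψs.gradient hU
    have hA : ContinuousOn (fun s => scalarGradNormSq (FunctionSpaces.Torus.partialDeriv j (φ s))) (Icc a t) := by
      have hc := (hg1.inner hg1).continuousOn_integral hconv
      refine hc.congr fun s _ => ?_
      simp only [scalarGradNormSq, real_inner_self_eq_norm_sq]
    have hB : ContinuousOn (fun s => ∫ x, FunctionSpaces.Torus.partialDeriv j (φ s) x *
        ⟪FunctionSpaces.Torus.partialDeriv j (u s) x, FunctionSpaces.Torus.gradient (φ s) x⟫_ℝ) (Icc a t) :=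
      (hψs.mul (((h'.smooth_velocity.partialDeriv hU j).inner
        (h'.smooth_scalar.gradient hU)))).continuousOn_integral hconv
    have c : ContinuousOn (fun s => -(2 * κ) * scalarGradNormSq (FunctionSpaces.Torus.partialDeriv j (φ s)) -
        2 * ∫ x, FunctionSpaces.Torus.partialDeriv j (φ s) x *
          ⟪FunctionSpaces.Torus.partialDeriv j (u s) x, FunctionSpaces.Torus.gradient (φ s) x⟫_ℝ)
        (Icc a t) := (continuousOn_const.mul hA).sub (continuousOn_const.mul hB)
    exact c
  have hEpos : ∀ s ∈ Icc a t, 0 ≤ E s := fun s _ => integral_nonneg fun x => sq_nonneg _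
  -- the streamwise derivative does not grow on `[a, t]`
  have hstream : ∀ s ∈ Icc a t, Real.sqrt (∫ x, (FunctionSpaces.Torus.partialDeriv i (φ s) x) ^ 2) ≤ P :=
    fun s hs => Real.sqrt_le_sqrt
      (h.integral_partialDeriv_sq_le_of_partialDeriv_velocity_eq_zero hκ hIt i
        (fun τ hτ x => hinv τ (hsubI hτ) x) hs)
  -- the forcing, pointwise: `⟪∂ⱼu, ∇φ⟫ = (∂ⱼuᵢ) ∂ᵢφ`, `|∂ⱼuᵢ| = ‖∂ⱼu‖ ≤ M`
  have hforce : ∀ s ∈ Icc a t, ∀ x,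
      |⟪FunctionSpaces.Torus.partialDeriv j (u s) x, FunctionSpaces.Torus.gradient (φ s) x⟫_ℝ| ≤
        M s * |FunctionSpaces.Torus.partialDeriv i (φ s) x| := by
    intro s hs x
    have hus : FunctionSpaces.Torus.IsSmooth (u s) := h'.smooth_velocity.isSmooth_slice hs
    have hφs : FunctionSpaces.Torus.IsSmooth (φ s) := h'.smooth_scalar.isSmooth_slice hs
    have hci : FunctionSpaces.Torus.IsContDiff 1 (fun y => u s y i) := (hus.apply i).isContDiff (by simp)
    have hce : FunctionSpaces.Torus.IsContDiff 1
        (fun _ : UnitAddTorus d => EuclideanSpace.single i (1 : ℝ)) :=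
      FunctionSpaces.Torus.isContDiff_const _
    have hu_eq : u s = fun y => (u s y i) • EuclideanSpace.single i (1 : ℝ) :=
      funext fun y => hdir s (hsubI hs) y
    have hconst : FunctionSpaces.Torus.partialDeriv j
        (fun _ : UnitAddTorus d => EuclideanSpace.single i (1 : ℝ)) x = 0 := by
      simp [FunctionSpaces.Torus.partialDeriv, FunctionSpaces.Torus.lineDeriv]
    have hdu : FunctionSpaces.Torus.partialDeriv j (u s) x =
        (FunctionSpaces.Torus.partialDeriv j (fun y => u s y i) x) • EuclideanSpace.single i (1 : ℝ) := by
      have h1 : FunctionSpaces.Torus.partialDeriv j (fun y => (u s y i) • EuclideanSpace.single i (1 : ℝ)) x =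
          (FunctionSpaces.Torus.partialDeriv j (fun y => u s y i) x) • EuclideanSpace.single i (1 : ℝ) := by
        rw [FunctionSpaces.Torus.partialDeriv_smul hci hce, hconst, smul_zero, zero_add]
      rw [← h1]
      exact congrArg (fun f => FunctionSpaces.Torus.partialDeriv j f x) hu_eq
    have hei : ⟪EuclideanSpace.single i (1 : ℝ), FunctionSpaces.Torus.gradient (φ s) x⟫_ℝ =
        FunctionSpaces.Torus.partialDeriv i (φ s) x := by
      rw [real_inner_comm, FunctionSpaces.Torus.inner_gradient_left,
        FunctionSpaces.Torus.partialDeriv_eq_fderiv_apply (hφs.isContDiff (by simp))]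
    have hnorm : ‖FunctionSpaces.Torus.partialDeriv j (u s) x‖ =
        |FunctionSpaces.Torus.partialDeriv j (fun y => u s y i) x| := by
      have hn1 : ‖EuclideanSpace.single i (1 : ℝ)‖ = 1 := by
        rw [← EuclideanSpace.basisFun_apply]
        exact (EuclideanSpace.basisFun d ℝ).orthonormal.1 i
      rw [hdu, norm_smul, hn1, mul_one, Real.norm_eq_abs]
    rw [hdu, real_inner_smul_left, hei, abs_mul]
    have hMx := hM s (hsubI hs) x
    rw [hnorm] at hMx
    exact mul_le_mul_of_nonneg_right hMx (abs_nonneg _)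
  -- the differential inequality `D ≤ 2 √E · (M P)`
  have hle : ∀ s ∈ Icc a t, D s ≤ 2 * Real.sqrt (E s) * (M s * P) := by
    intro s hs
    have hφs : FunctionSpaces.Torus.IsSmooth (φ s) := h'.smooth_scalar.isSmooth_slice hs
    have hus : FunctionSpaces.Torus.IsSmooth (u s) := h'.smooth_velocity.isSmooth_slice hs
    have hψj : FunctionSpaces.Torus.IsSmooth (FunctionSpaces.Torus.partialDeriv j (φ s)) := hφs.partialDeriv j
    have hψi : FunctionSpaces.Torus.IsSmooth (FunctionSpaces.Torus.partialDeriv i (φ s)) := hφs.partialDeriv i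
    have hMs : 0 ≤ M s := (norm_nonneg _).trans (hM s (hsubI hs) (0 : UnitAddTorus d))
    -- (i) the viscous term
    have i1 : -(2 * κ) * scalarGradNormSq (FunctionSpaces.Torus.partialDeriv j (φ s)) ≤ 0 := by
      have := scalarGradNormSq_nonneg (FunctionSpaces.Torus.partialDeriv j (φ s))
      nlinarith
    -- (ii) the forcing term
    have i_src : Integrable (fun x => FunctionSpaces.Torus.partialDeriv j (φ s) x *
        ⟪FunctionSpaces.Torus.partialDeriv j (u s) x, FunctionSpaces.Torus.gradient (φ s) x⟫_ℝ) volume :=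
      (hψj.smul' ((hus.partialDeriv j).inner hφs.gradient)).integrable
    have i_bd : Integrable (fun x => M s * (|FunctionSpaces.Torus.partialDeriv j (φ s) x| *
        |FunctionSpaces.Torus.partialDeriv i (φ s) x|)) volume :=
      ((hψj.continuous.abs.mul hψi.continuous.abs).integrable_unitAddTorus).const_mul _
    have h1 : -(∫ x, FunctionSpaces.Torus.partialDeriv j (φ s) x *
        ⟪FunctionSpaces.Torus.partialDeriv j (u s) x, FunctionSpaces.Torus.gradient (φ s) x⟫_ℝ) ≤
        ∫ x, M s * (|FunctionSpaces.Torus.partialDeriv j (φ s) x| *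
          |FunctionSpaces.Torus.partialDeriv i (φ s) x|) := by
      rw [← integral_neg]
      refine integral_mono i_src.neg i_bd fun x => ?_
      have hf := hforce s hs x
      have : -(FunctionSpaces.Torus.partialDeriv j (φ s) x *
          ⟪FunctionSpaces.Torus.partialDeriv j (u s) x, FunctionSpaces.Torus.gradient (φ s) x⟫_ℝ) ≤
          |FunctionSpaces.Torus.partialDeriv j (φ s) x| *
            |⟪FunctionSpaces.Torus.partialDeriv j (u s) x, FunctionSpaces.Torus.gradient (φ s) x⟫_ℝ| := by
        rw [← abs_mul]
        exact neg_le_abs _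
      calc -(FunctionSpaces.Torus.partialDeriv j (φ s) x *
            ⟪FunctionSpaces.Torus.partialDeriv j (u s) x, FunctionSpaces.Torus.gradient (φ s) x⟫_ℝ)
          ≤ |FunctionSpaces.Torus.partialDeriv j (φ s) x| *
            |⟪FunctionSpaces.Torus.partialDeriv j (u s) x, FunctionSpaces.Torus.gradient (φ s) x⟫_ℝ| := this
        _ ≤ |FunctionSpaces.Torus.partialDeriv j (φ s) x| *
            (M s * |FunctionSpaces.Torus.partialDeriv i (φ s) x|) :=
            mul_le_mul_of_nonneg_left hf (abs_nonneg _)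
        _ = M s * (|FunctionSpaces.Torus.partialDeriv j (φ s) x| *
            |FunctionSpaces.Torus.partialDeriv i (φ s) x|) := by ring
    have h2 : ∫ x, M s * (|FunctionSpaces.Torus.partialDeriv j (φ s) x| *
        |FunctionSpaces.Torus.partialDeriv i (φ s) x|) ≤ M s * (Real.sqrt (E s) * P) := by
      rw [integral_const_mul]
      refine mul_le_mul_of_nonneg_left ?_ hMs
      have hcs := FunctionSpaces.Torus.integral_mul_le_sqrt_mul_sqrt hψj.continuous.abs hψi.continuous.abs
      have e1 : (∫ x, |FunctionSpaces.Torus.partialDeriv j (φ s) x| ^ 2) = E s := by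
        simp only [hE_def, sq_abs]
      have e2 : (∫ x, |FunctionSpaces.Torus.partialDeriv i (φ s) x| ^ 2) =
          ∫ x, (FunctionSpaces.Torus.partialDeriv i (φ s) x) ^ 2 := by
        simp only [sq_abs]
      rw [e1, e2] at hcs
      exact hcs.trans (mul_le_mul_of_nonneg_left (hstream s hs) (Real.sqrt_nonneg _))
    have hD : D s = -(2 * κ) * scalarGradNormSq (FunctionSpaces.Torus.partialDeriv j (φ s)) -
        2 * ∫ x, FunctionSpaces.Torus.partialDeriv j (φ s) x *
          ⟪FunctionSpaces.Torus.partialDeriv j (u s) x, FunctionSpaces.Torus.gradient (φ s) x⟫_ℝ := rfl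
    rw [hD]
    nlinarith [h1.trans h2]
  have hg0 : ∀ s ∈ Icc a t, 0 ≤ M s * P := fun s hs =>
    mul_nonneg ((norm_nonneg _).trans (hM s (hsubI hs) (0 : UnitAddTorus d))) hP0
  have hgc : ContinuousOn (fun s => M s * P) (Icc a t) := (hMc.mono hsubI).mul continuousOn_const
  have hmain := sqrt_le_sqrt_add_integral_Icc hat.le hEd hDc hEpos hle hg0 hgc
  rw [intervalIntegral.integral_mul_const] at hmain
  exact hmain

end Shear

end IsClassicalScalarTransportOn

end Torus

end Literature.Analysis.FluidPDE

end
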